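import Summits.BirchSwinnertonDyer.BirchSwinnertonDyer.Theorems.GenusKolyvaginAtTwoVisiblePairAtTwoCasselsTateKernel
import Summits.BirchSwinnertonDyer.BirchSwinnertonDyer.Theorems.CMKolyvaginAtInertTwoPairDataInputsAtTwo
import Literature.NumberTheory.EllipticCurves.CasselsTateLevelAssembly
import HarnessLib

/-!
# Route `CMKolyvaginAtInertTwo`, crux `CMKolyvaginExactAtInertTwo` (stmt-BirchSwinnertonDyer-24277):
# the RANK-ONE member's abstract inputs of the path-(β) T2 assembly — `ker ι₁ = ℤ x₁` from a generator of
# `E(F)` modulo odd torsion, and `ord x₁ = exp Sel`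

Seat `bsd-line-cmk2-p1` g17 (cell `bsd-print-cf2`); helper (`--supports stmt-BirchSwinnertonDyer-24277`).
THEOREMS ONLY: no definition, no named fact, no `sorry`; no item is closed; BSD is not proved by this.

`card_mul_card_le_two_pow_two_mul_of_pairData_cmInert` (this seat) displays on the rank-one member: a class
`x₁ ∈ Sel_{2^M}(E)` (`= D.x = δ_M x₀`) with `ker ι₁ = ℤ x₁` for `ι₁ : Sel_{2^M} → Ш[2^L]` lifting
`H¹(ℚ, E[2^M]) → H¹(ℚ, E)`, and `ord x₁ = exp Sel_{2^M}(E)`. Here (any number field `F`, any curve `A`):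

* `ker_selmerToSha_eq_zmultiples_of_generator` — if `A(F)` has no `2`-torsion and `g ∈ A(F)` generates `A(F)`
  modulo torsion (`∀ P, ∃ n t, t` torsion `∧ P = n • g + t` — rank ONE), then for `x₀ = k • g + t₀` with `k` ODD
  and `t₀` torsion, the kernel of `ι` is `ℤ δ_M(x₀)`: a class dying in `H¹(F, A)` is `δ_M(P)` (Kummer exactness,
  `exists_kummerMapTorsion_eq_of_torsionH1ToH1_eq_zero`), `δ_M` kills odd-order torsion
  (`exists_two_pow_zsmul_eq_of_isOfFinAddOrder`), and `δ_M(g) = k' δ_M(x₀)` for `k k' ≡ 1 (mod 2^M)`;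
* `addOrderOf_eq_exponent_of_forall_nsmul_eq_zero` — an element of order `n` in a group killed by `n` has
  order the exponent (pure algebra; `ord x₁ = 2^M = exp Sel_{2^M}` from `2^{M-1} x₁ ≠ 0`).

On H₂ the generator input is Mordell–Weil + `rank E(ℚ) = 1` (GZK, route fact) + `E(ℚ)[2] = 0`; `x₀` with
`2^{M₀} x₀ = y_K`, `x₀ ∉ 2E(ℚ)` is an odd multiple of `g` modulo torsion. References: [SilvermanAEC2009] VIII.§2, X.4.2;
[McCallumLMS1991] §5 Lemma 5.1, Thm. 5.4.
-/

-- single-conjunct summit: `Summit.BirchSwinnertonDyer.BirchSwinnertonDyer.…` repeats the name by design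
set_option linter.dupNamespace false
set_option autoImplicit false

noncomputable section

open scoped Classical
open scoped AddSubgroup

namespace Summit.BirchSwinnertonDyer.BirchSwinnertonDyer.Theorems.KolyvaginPairDataTwo

open WeierstrassCurve NumberField Field
open Literature.NumberTheory.EllipticCurves Literature.NumberTheory.GaloisRepresentations
open Summit.BirchSwinnertonDyer.BirchSwinnertonDyer.Theorems.GenusExact.VisiblePairAtTwo

/-! ## Pure algebra: order = exponent -/

/-- In an additive group killed by `n`, an element of order `n` has order equal to the exponent. [folklore]
[cite: McCallumLMS1991, §5 Lemma 5.1 (x of order p^M)] -/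
theorem addOrderOf_eq_exponent_of_forall_nsmul_eq_zero {G : Type*} [AddCommGroup G] {n : ℕ}
    (hG : ∀ g : G, n • g = 0) {x : G} (hx : addOrderOf x = n) : addOrderOf x = AddMonoid.exponent G := by
  have h1 : AddMonoid.exponent G ∣ n := AddMonoid.exponent_dvd_of_forall_nsmul_eq_zero hG
  have h2 : addOrderOf x ∣ AddMonoid.exponent G := AddMonoid.addOrder_dvd_exponent x
  rw [hx] at h2 ⊢
  exact Nat.dvd_antisymm h2 h1

/-! ## The kernel of `ι : Sel_{2^M} → Ш[2^L]` on the rank-one member -/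

section RankOne

variable {F : Type} [Field F] [NumberField F] (A : WeierstrassCurve F) [A.IsElliptic] (M L : ℕ)

/-- **`ker ι = ℤ δ_M(x₀)` on a rank-one member without `2`-torsion.** `g` generates `A(F)` modulo torsion,
`A(F)[2] = 0`, `x₀ = k • g + t₀` with `k` odd and `t₀` torsion, `ι : Sel_{2^M}(A/F) → Ш(A/F)[2^L]` lifts
`H¹(F, A[2^M]) → H¹(F, A)`, and `x₁ ∈ Sel_{2^M}` is the Kummer class `δ_M(x₀)`: then `ker ι = ℤ x₁`.
[cite: SilvermanAEC2009, VIII.§2 and Thm. X.4.2 (a)] [cite: McCallumLMS1991, §5 Lemma 5.1] -/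
theorem ker_selmerToSha_eq_zmultiples_of_generator
    (h2 : ∀ P : A.toAffine.Point, (2 : ℤ) • P = 0 → P = 0)
    (g : A.toAffine.Point)
    (hgen : ∀ P : A.toAffine.Point, ∃ (n : ℤ) (t : A.toAffine.Point), IsOfFinAddOrder t ∧ P = n • g + t)
    {x₀ t₀ : A.toAffine.Point} {k : ℕ} (hk : Odd k) (ht₀ : IsOfFinAddOrder t₀) (hx₀ : x₀ = (k : ℤ) • g + t₀)
    (ι : selmerGroup A (lvl M) →+ (A.sha)[(2 ^ L : ℕ)])
    (hι : ∀ z, shaTorsionVal A (2 ^ L) (ι z) = torsionH1ToH1 A (lvl M) z)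
    (x₁ : selmerGroup A (lvl M))
    (hx₁ : (x₁ : galH1Torsion A (lvl M)) =
      kummerMapTorsion A (lvl M) (A.zsmul_geomPoints_surjective_holds (lvl_ne_zero M)) x₀) :
    ι.ker = AddSubgroup.zmultiples x₁ := by
  set κ := kummerMapTorsion A (lvl M) (A.zsmul_geomPoints_surjective_holds (lvl_ne_zero M)) with hκ
  -- `κ` kills torsion (odd order, hence `2^M`-divisible)
  have hκt : ∀ t : A.toAffine.Point, IsOfFinAddOrder t → κ t = 0 := by
    intro t ht
    obtain ⟨u, hu⟩ := exists_two_pow_zsmul_eq_of_isOfFinAddOrder h2 ht M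
    rw [(kummerMapTorsion_eq_zero_iff A M t)]
    exact ⟨u • t, hu⟩
  -- `ι z = 0 ↔ torsionH1ToH1 z = 0`
  have hιker : ∀ z : selmerGroup A (lvl M), ι z = 0 ↔ torsionH1ToH1 A (lvl M) z = 0 := by
    intro z
    rw [← hι]
    constructor
    · intro h
      rw [h]
      rfl
    · intro h
      exact Subtype.ext (Subtype.ext h)
  -- `κ g = k' • x₁` for `k k' ≡ 1 (mod 2^M)`
  have hκg : ∃ k' : ℤ, κ g = k' • (x₁ : galH1Torsion A (lvl M)) := by
    by_cases hM : M = 0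
    · -- level `2^0 = 1`: everything is killed by `1`
      refine ⟨0, ?_⟩
      subst hM
      have h := zsmul_galH1Torsion_eq_zero A (lvl 0) (κ g)
      have e : (lvl 0 : ℤ) = 1 := by simp [lvl]
      have h1 : (1 : ℤ) • κ g = 0 := by
        have h2 := congrArg (fun c : ℤ => c • κ g) e
        rw [← h2]
        exact h
      rw [one_zsmul] at h1
      rw [h1, zero_zsmul]
    have h1 : 1 < 2 ^ M := Nat.one_lt_two_pow hM
    have hcop : Nat.Coprime k (2 ^ M) := ((Nat.coprime_two_left.mpr hk).pow_left M).symm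
    obtain ⟨u, -, hu⟩ := Nat.exists_mul_mod_eq_one_of_coprime hcop h1
    obtain ⟨q, hq⟩ : ∃ q : ℕ, k * u = 2 ^ M * q + 1 :=
      ⟨k * u / 2 ^ M, by have h := Nat.div_add_mod (k * u) (2 ^ M); rw [hu] at h; exact h.symm⟩
    refine ⟨(u : ℤ), ?_⟩
    -- `(u * k) • κ g = κ g` since `k u = 2^M q + 1`
    have hdecomp : ((u : ℤ) * (k : ℤ)) = 1 + (lvl M : ℤ) * (q : ℤ) := by
      have h' : ((k * u : ℕ) : ℤ) = ((2 ^ M * q + 1 : ℕ) : ℤ) := by rw [hq]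
      push_cast at h'
      rw [mul_comm]
      simp only [lvl, Nat.cast_pow, Nat.cast_ofNat]
      linarith
    rw [hx₁, hx₀, map_add, hκt t₀ ht₀, add_zero, map_zsmul, smul_smul, hdecomp, add_zsmul, one_zsmul,
      ← smul_smul, zsmul_galH1Torsion_eq_zero, add_zero]
  obtain ⟨k', hk'⟩ := hκg
  ext z
  rw [AddMonoidHom.mem_ker, hιker, AddSubgroup.mem_zmultiples_iff]
  constructor
  · intro hz
    obtain ⟨P, hP⟩ := exists_kummerMapTorsion_eq_of_torsionH1ToH1_eq_zero A M hz
    obtain ⟨n, t, ht, rfl⟩ := hgen P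
    refine ⟨n * k', Subtype.ext ?_⟩
    rw [AddSubgroupClass.coe_zsmul, ← hP, map_add, hκt t ht, add_zero, map_zsmul, hk', smul_smul]
  · rintro ⟨a, rfl⟩
    rw [AddSubgroupClass.coe_zsmul, map_zsmul, hx₁, hκ, torsionH1ToH1_kummerMapTorsion, zsmul_zero]

end RankOne

end Summit.BirchSwinnertonDyer.BirchSwinnertonDyer.Theorems.KolyvaginPairDataTwo

end
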